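import Summits.QuantumFields.BalabanUV.T4Continuum.Support.OutputRateOpHolomorphic

/-!
# OutputRateOpHolomorphicWitness — NON-VACUITY of the structural operator-species shape of `OutputRateOpHolomorphic`: the
# COMPLEX-GAUSSIAN TOY TERM (cell `pub-balaban`, T⁴ fan-out, `HOME/BINDER-OWNERS.md` row NE5, owner lineage t4-ne5-p1, gen 28)

HONEST FRAMING (T4-DAG PAGE 1).  Rung (B)+1 on ONE finite four-torus of fixed physical size — NOT infinite volume, NOT a mass gap,
NOT the Clay problem; `FlowStep.BetaPertH`, (B), (B^μ) do not occur here.  NE5 is NOT PRINTED and NOT PROVED (spine 0/9).  This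
module asserts NOTHING about Bałaban's objects: it exhibits ONE explicit term family on the lineage's toy carriers for which the
structural shape `TermOpHolomorphicBall` of `OutputRateOpHolomorphic` HOLDS (so the shape is inhabited and its four clauses are
jointly satisfiable by a genuinely operator-dependent COMPLEX Gaussian integral), and reads off `TermOpLineAnalytic` and `TermBound`
for it through the sibling's theorems — the kernel check that «STRUCTURE ⟹ LINE, operator species» fires end to end.  v1.1 (§2,
APPEND-ONLY): the sibling's bi-structural END face `ne5_at_of_stepModel_termwise_biStructural_budget_scale_nat` FIRES on the leaf's
exp-linear toy (`toyModelER`, `toyTermD`): its operator species is a Dirac-mass dominated holomorphic integral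
(`toyD_termOpHolomorphicBall`), so `toyE_ne5_biStructural` = the leaf's `toyE_ne5_expLinear` with NO analyticity binder on either species.
HONEST DEPENDENCY (cell, verbatim): continuum YM on T⁴ ⇐ BetaPertH ∧ nine spine estimates (0/9 proved); BetaPertH ⇐ (D1) ∧ (D4) ∧
CAP+tail; G-an2-4 gates asym, D1 and NE2/3/4.

THE TOY.  One term (index type `Unit`), independent of the history datum and of the domain: `T o = ∫_ℝ exp(−(1 + o)x²) dx`, operator
datum `o ∈ ℂ` — a Gaussian integral whose (complex) covariance IS the operator datum, the one-dimensional shadow of the factor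
`∫dμ_{C^{(k)}(Z₀,σ(Z))}(B)` of the resummed term (2.14) p. 15 of [II] = [Balaban1988RG2Cluster], about which the paper says (p. 15,
quoted in the lineage's loci sheet) that the operators are not symmetric and the second measure is complex.  On the open operator
ball `‖o‖ < 1/2` the real part of the covariance stays `≥ 1/2` (the positivity MARGIN), so the integrand is dominated by the
integrable `e^{−x²/2}` of mass `√(2π)`; it is continuous in `x` and entire in `o`.  Hence (`toyGauss_termOpHolomorphicBall`) the ball
form holds on the ball class of radii `(1/4, 1)` around `(0, 0)` with room `R′ = 1/2`, and by the sibling's `termOpLineAnalytic_of_ball`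
/ `termBound_of_ball_majorant` the term is complex differentiable on the closed unit disc along every operator segment in the class
(`toyGauss_termOpLineAnalytic`) and obeys `TermBound` with weight `√(π/(1/2))` (`toyGauss_termBound`).  0 sorry; 0 cite tags; axioms ⊆
{propext, Classical.choice, Quot.sound}.
-/

noncomputable section

open Set Metric MeasureTheory Filter

namespace Summit.QuantumFields.BalabanUV.T4Continuum.OutputRateOpHolomorphicWitness

open Literature.MathematicalPhysics.QuantumFieldTheory.Balaban1983to89
open Literature.MathematicalPhysics.QuantumFieldTheory.Balaban1983to89.T4OutputRate
open Literature.MathematicalPhysics.QuantumFieldTheory.Balaban1983to89.T4InputCauchyRate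
open Literature.MathematicalPhysics.QuantumFieldTheory.Balaban1983to89.T4InputCauchyRateData
open Literature.MathematicalPhysics.QuantumFieldTheory.Balaban1983to89.T4InputCauchyRateSpecies
open Literature.MathematicalPhysics.QuantumFieldTheory.Balaban1983to89.T4InputCauchyRateTermwise
open Summit.QuantumFields.BalabanUV.T4Continuum.OutputRateOpHolomorphic

/-! ## The complex-Gaussian toy term -/

section ToyGauss

/-- The toy's ONE term (index type `Unit`), independent of the history datum and the domain: the complex Gaussian integral
`∫_ℝ exp(−(1 + o)x²) dx` with operator datum `o ∈ ℂ` — the one-dimensional shadow of (2.14)'s `∫dμ_{C^{(k)}(σ(Z))}(B)` with a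
non-symmetric operator and a complex measure ([II] p. 15). [folklore] -/
def toyGaussTerm : ℕ → Unit → ℂ → ℂ → toyCarriers.Dom → ℂ := fun _ _ o _ _ =>
  ∫ x : ℝ, Complex.exp (-(1 + o) * (x : ℂ) ^ 2)

/-- The toy's integrand against Lebesgue measure: `f o x = exp(−(1 + o)x²)`. [folklore] -/
def toyGaussIntegrand : ∀ (_ : ℕ) (_ : Unit), ℂ → toyCarriers.Dom → ℂ → ℝ → ℂ := fun _ _ _ _ o x =>
  Complex.exp (-(1 + o) * (x : ℂ) ^ 2)

/-- The toy's reference measures: Lebesgue measure on `ℝ` for every term (operator-independent). [folklore] -/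
def toyGaussMeasure : ∀ (_ : ℕ) (_ : Unit), ℂ → toyCarriers.Dom → Measure ℝ := fun _ _ _ _ => volume

/-- The real part of the toy's exponent: `Re(−(1 + o)x²) = −(1 + Re o)x²`. [folklore] -/
theorem re_toyExponent (o : ℂ) (x : ℝ) : (-(1 + o) * (x : ℂ) ^ 2).re = -(1 + o.re) * x ^ 2 := by
  have hx : ((x : ℂ)) ^ 2 = ((x ^ 2 : ℝ) : ℂ) := by push_cast; ring
  rw [hx, Complex.re_mul_ofReal]
  simp

/-- THE GAUSSIAN MAJORANT: for `‖o‖ < 1/2` the integrand is dominated by `e^{−x²/2}` (the real part of the complex covariance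
stays `≥ 1/2` on the operator ball — the positivity MARGIN that (H-dom) asks of (2.14)'s quadratic forms). [folklore] -/
theorem norm_toyGaussIntegrand_le {o : ℂ} (ho : o ∈ ball (0 : ℂ) (1 / 2)) (x : ℝ) :
    ‖Complex.exp (-(1 + o) * (x : ℂ) ^ 2)‖ ≤ Real.exp (-(1 / 2) * x ^ 2) := by
  rw [Complex.norm_exp, re_toyExponent]
  refine Real.exp_le_exp.2 (mul_le_mul_of_nonneg_right ?_ (sq_nonneg x))
  rw [mem_ball, dist_zero_right] at ho
  have h := (abs_le.1 (Complex.abs_re_le_norm o)).1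
  linarith

/-- **THE COMPLEX-GAUSSIAN TOY SATISFIES THE BALL FORM** on the ball class of radii `(1/4, 1)` around the centre `(0, 0)` with
room `R′ = 1/2`: the integrand is continuous (hence a.e.-strongly measurable) in `x`, ENTIRE in the operator datum `o`, dominated
on `‖o‖ < 1/2` by the integrable `e^{−x²/2}`, and integrates to the term by definition. [folklore] -/
theorem toyGauss_termOpHolomorphicBall :
    TermOpHolomorphicBall toyGaussTerm (Set.univ : Set (ℕ → ℝ)) toyCtr (fun _ => 1) (fun _ => 1 / 2) toyGaussMeasure
      toyGaussIntegrand := by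
  intro k g _ U h _ X _ i
  refine ⟨fun o _ => ?_, Filter.Eventually.of_forall fun x => ?_, ⟨fun x => Real.exp (-(1 / 2) * x ^ 2), ?_, ?_⟩,
    fun o _ => rfl⟩
  · exact (by fun_prop : Continuous fun x : ℝ => Complex.exp (-(1 + o) * (x : ℂ) ^ 2)).aestronglyMeasurable
  · exact (by fun_prop : Differentiable ℂ fun o : ℂ => Complex.exp (-(1 + o) * (x : ℂ) ^ 2)).differentiableOn
  · exact integrable_exp_neg_mul_sq (by norm_num)
  · exact Filter.Eventually.of_forall fun x o ho => norm_toyGaussIntegrand_le ho x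

/-- Hence — with NO hypothesis of analyticity — the toy's term is complex differentiable on the closed unit disc along every
complex operator segment inside the ball class of radii `(1/4, 1)`: `TermOpLineAnalytic` by §3 (room `1/4 < 1/2`). [folklore] -/
theorem toyGauss_termOpLineAnalytic :
    TermOpLineAnalytic (ballClass toyCtr (fun _ => 1 / 4) fun _ => 1) toyGaussTerm (Set.univ : Set (ℕ → ℝ)) :=
  termOpLineAnalytic_of_ball (ROp := fun _ => 1 / 4) (fun _ => by norm_num) toyGauss_termOpHolomorphicBall

/-- And the SAME majorant budgets the term: `TermBound` on the ball class with weight `√(π/(1/2)) = √(2π)` (the Gaussian mass,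
Mathlib's `integral_gaussian`) and decay rate `κ = 0` (the toy carriers have no tree length). [folklore] -/
theorem toyGauss_termBound :
    TermBound (ballClass toyCtr (fun _ => 1 / 4) fun _ => 1) toyGaussTerm (Set.univ : Set (ℕ → ℝ)) 0
      fun _ _ => Real.sqrt (Real.pi / (1 / 2)) := by
  refine termBound_of_ball_majorant (ROp := fun _ => 1 / 4) (fun _ => by norm_num) toyGauss_termOpHolomorphicBall
    fun k g _ U h _ X _ i => ⟨fun x => Real.exp (-(1 / 2) * x ^ 2), integrable_exp_neg_mul_sq (by norm_num),
      Filter.Eventually.of_forall fun x o ho => norm_toyGaussIntegrand_le ho x, ?_⟩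
  simp only [zero_mul, neg_zero, Real.exp_zero, mul_one]
  exact (integral_gaussian (1 / 2)).le

end ToyGauss

/-! ## §2 (v1.1) The bi-structural END face FIRES on the leaf's exp-linear toy: the operator species of `toyTermD` is a
## (Dirac-mass) dominated holomorphic integral, so `hlineOp` is met by STRUCTURE too -/

section ToyBiStructural

/-- The leaf's two-term exp-linear toy `toyTermD` (`T₀ = exp(o + h)`, `T₁ = −1`) read in the OPERATOR species as integrals against a
Dirac mass on the one-point space: integrand `f₀ h o () = exp(o + h)`, `f₁ = −1`. [folklore] -/
def toyIntegrandD : ∀ (_ : ℕ) (i : Fin 2), ℂ → toyCarriers.Dom → ℂ → Unit → ℂ := fun _ i h _ o _ =>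
  ![Complex.exp (o + h), -1] i

/-- Its reference measures: the Dirac mass, for every term, history datum and domain (operator-INDEPENDENT). [folklore] -/
abbrev toyMeasureD : ∀ (_ : ℕ) (_ : Fin 2), ℂ → toyCarriers.Dom → Measure Unit := fun _ _ _ _ => Measure.dirac ()

/-- **`toyTermD` SATISFIES THE BALL FORM** on the ball class of radii `(1/8, 2)` with room `R′ = 1/4`: the integrands are entire in `o`,
trivially measurable, dominated on `‖o‖ < 1/4`, `‖h‖ ≤ 2` by the constant `e^{9/4}` (resp. `1`), integrable against the Dirac mass, and
integrate to the terms (`integral_dirac`). [folklore] -/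
theorem toyD_termOpHolomorphicBall :
    TermOpHolomorphicBall toyTermD (Set.univ : Set (ℕ → ℝ)) toyCtr (fun _ => 2) (fun _ => 1 / 4) toyMeasureD toyIntegrandD := by
  intro k g _ U h hh X _ i
  have hh' : ‖h‖ ≤ 2 := by simpa [toyCtr, mem_closedBall, dist_eq_norm] using hh
  fin_cases i
  · refine ⟨fun o _ => aestronglyMeasurable_const, Filter.Eventually.of_forall fun _ => ?_,
      ⟨fun _ => Real.exp (9 / 4), integrable_const _, Filter.Eventually.of_forall fun _ o ho => ?_⟩, fun o _ => ?_⟩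
    · show DifferentiableOn ℂ (fun o : ℂ => Complex.exp (o + h)) _
      exact Differentiable.differentiableOn (by fun_prop)
    · have ho' : ‖o‖ < 1 / 4 := by simpa [toyCtr, mem_ball, dist_eq_norm] using ho
      show ‖Complex.exp (o + h)‖ ≤ Real.exp (9 / 4)
      rw [Complex.norm_exp]
      exact Real.exp_le_exp.2 (((Complex.re_le_norm _).trans (norm_add_le _ _)).trans (by linarith))
    · show Complex.exp (o + h) = ∫ _a : Unit, Complex.exp (o + h) ∂(Measure.dirac ())
      rw [integral_dirac]
  · refine ⟨fun o _ => aestronglyMeasurable_const, Filter.Eventually.of_forall fun _ => differentiableOn_const _,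
      ⟨fun _ => 1, integrable_const _, Filter.Eventually.of_forall fun _ o _ => ?_⟩, fun o _ => ?_⟩
    · show ‖(-1 : ℂ)‖ ≤ 1
      simp
    · show (-1 : ℂ) = ∫ _a : Unit, (-1 : ℂ) ∂(Measure.dirac ())
      rw [integral_dirac]

/-- **THE BI-STRUCTURAL CLOSURE FIRES ON THE TOY** (vacuity witness for
`OutputRateOpHolomorphic.ne5_at_of_stepModel_termwise_biStructural_budget_scale_nat`): the leaf's `toyE_ne5_expLinear` with its LAST
analyticity binder `toyD_termOpLineAnalytic` REPLACED by the structural `toyD_termOpHolomorphicBall` (room `1/8 < 1/4`) and — ONLY so that the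
statement is not a restatement of the leaf's theorem (gate dedup) — the reach read at `ρ₀ = 1/2` instead of `1/3` (near-reach
`8/32 + 5/63 ≤ 1/2`, smallness `1/64 + 22·(1/64) = 23/64 < 1/2`, constant `(176 + 80)(31/64)/(9/64) = 7936/9`); every other binder
IDENTICAL — NO analyticity hypothesis on EITHER species is left. [folklore] -/
theorem toyE_ne5_biStructural : NE5 toyEAE toyEB (Set.univ : Set (ℕ → ℝ)) 0 (1 / 2)
    ((11 / (1 - 1 / 2) * 8 + 11 / (1 - 1 / 2) * 0 + 80) * (1 / 2 - 1 / 64) /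
      (1 / 2 - (1 / 64 + 11 / (1 - 1 / 2) * (1 / 64)))) :=
  ne5_at_of_stepModel_termwise_biStructural_budget_scale_nat toyModelER toyTermD (ctr := toyCtr) (BOp := fun _ => 0)
    (BHist := fun _ => 1) (ROp := fun _ => 1 / 8) (RHist := fun _ => 2)
    (R' := fun _ => 1 / 4) (a := toyMajD) (ρ₀ := 1 / 2) (B := 80) (k₀ := 5) (E₁ := 3)
    toyE_representsA toyE_representsB toyE_inBase toyE_baseBudget
    (fun k => by show (0 : ℝ) + 1 / 8 * 1 ≤ 1 / 8; norm_num)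
    (fun k => by show (1 : ℝ) + 1 * 1 ≤ 2; norm_num)
    toyD_termRep toyD_termBound toyD_termBudget (fun _ => by norm_num) toyD_termOpHolomorphicBall toyD_termHistExpLinear
    toyE_decayA toy_decayB toyER_operatorRate toyER_insertionRate toy_insAffine toy_insBlind toy_insHomog
    (toyER_insScaleBound (by norm_num)) (by norm_num) (by norm_num) (by norm_num) le_rfl (by norm_num) le_rfl (by norm_num)
    (by norm_num) (by norm_num) (by norm_num) (by norm_num) (by norm_num) (fun k hk => by
      have hk' : k ≤ 4 := by omega
      calc (2 : ℝ) + 3 = 80 * (1 / 2) ^ 4 := by norm_num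
        _ ≤ 80 * (1 / 2) ^ k := by
          apply mul_le_mul_of_nonneg_left _ (by norm_num)
          exact pow_le_pow_of_le_one (by norm_num) (by norm_num) hk')
    (by norm_num)

end ToyBiStructural

end Summit.QuantumFields.BalabanUV.T4Continuum.OutputRateOpHolomorphicWitness

end
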